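import Summits.QuantumAdvantage.AdviceFreeQNC0.AffBells29Peeling
import HarnessLib

/-!
# Sketch29 v3, part 2/5 (planner qn-p1 g29, ROUND-28): §29.4 WINDOW LAWS (β-adapted, kernel-line measurable: `Law`, `StableLaw`, `mass`, …) and the weighted double count (PROVED)

(VERBATIM slice of `HOME/qa-qnc0-p1/exp29/Sketch29.lean` (sha16 `d7934601fa3f468f`, 1191 l., farm rc 0 / 0 sorry / 0 warnings), authored AND
proved by the planner seat qn-p1 g29; landed by the prover seat qn-prover-3 g14 (ask P-29b) as five files (400-line rule).  Changes: file
boundaries with per-file preamble, one-line docstrings on undocumented auxiliaries (lint), and in part 1 the planner's re-proofs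
`AffBells29.peeling/peelingList` are omitted in favour of the landed `AffBells28.peeling/peelingList` (gate dedup), as the ask allows.)
WHAT THIS IS NOT: `HClassA` (the one remaining c-free conjecture of the (NP₁) plan) is NOT touched; separation NOT moved.
-/

namespace Summit.QuantumAdvantage.AdviceFreeQNC0

namespace AffBells29

open Finset Literature.Computability.QuantumComplexity Literature.Computability.QuantumComplexity.RingHLF
open AffBells23 AffBells26 Fib19 AffBells27 AffBells28

variable {N : ℕ}

/-! ### §29.4 WINDOW LAWS (β-adapted, kernel-line measurable) and the weighted double count (PROVED)

The landed double count (`AffBells28.subDoubleCount`) weights the `Z`-coin windows of `x` UNIFORMLY (`1/#PZ(x)`).  Nothing in the count uses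
uniformity: ANY non-negative weights that depend on `x` only through its kernel line `J(x)` and have total mass `≤ 1` per line work, because a lost
point `ℓ ∈ SubFibre x C₀` has the same kernel line as `x` (same weights, same windows) and at most `2^Z` points `x` see it.  So the WINDOW LAW is
FREE and may be ADAPTED TO `β` (e.g. windows inside the support of a host row, §29.5) — this is what dissolves the block-diagonal obstruction to
isolation (uniform `K·log N`-coin windows almost never put `log N` coins into one `√N`-block; a law concentrated on blocks always does). -/

/-- Coins of a kernel line (`klineZeros x` is `lineZeros (kline x)` by `rfl`). -/
def lineZeros (J : Fin N → Bool) : Finset (Fin N) := univ.filter fun i => J i = false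

/-- Auxiliary step `klineZeros_eq_lineZeros` of Sketch29 (planner qa-qnc0-p1 g29, v3, verbatim). -/
theorem klineZeros_eq_lineZeros (x : Fin N → Bool) : klineZeros x = lineZeros (kline x) := rfl

/-- A WINDOW LAW at `Z` coins: non-negative weights on windows, a function of the kernel line, of total mass `≤ 1` on the `Z`-coin windows of
each line. -/
def WindowLaw (Z : ℕ) (ω : (Fin N → Bool) → Finset (Fin N) → ℝ) : Prop :=
  (∀ J C₀, 0 ≤ ω J C₀) ∧ ∀ J : Fin N → Bool, ∑ C₀ ∈ (lineZeros J).powersetCard Z, ω J C₀ ≤ 1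

open scoped Classical in
/-- The `ω`-MASS of the certificate `W` for `(β, c)`: `Σ_{x odd} Σ_{C₀ ∈ PZ(x)} ω(J(x), C₀)·[W β c x C₀]`. -/
noncomputable def mass (W : ∀ {N : ℕ}, (Fin N → Fin N → ZMod 3) → (Fin N → ZMod 3) → (Fin N → Bool) → Finset (Fin N) → Prop)
    (Z : ℕ) (ω : (Fin N → Bool) → Finset (Fin N) → ℝ) (β : Fin N → Fin N → ZMod 3) (c : Fin N → ZMod 3) : ℝ :=
  ∑ x ∈ univ.filter (fun x : Fin N → Bool => IsOdd x), ∑ C₀ ∈ (klineZeros x).powersetCard Z, if W β c x C₀ then ω (kline x) C₀ else 0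

open scoped Classical in
/-- Inner bound of the weighted count: a point `y` receives total weight `≤ 2^Z`. -/
theorem inner_le_law {Z : ℕ} {ω : (Fin N → Bool) → Finset (Fin N) → ℝ} (hω : WindowLaw Z ω) (y : Fin N → Bool) :
    (∑ x ∈ univ.filter (fun x : Fin N → Bool => IsOdd x), ∑ C₀ ∈ (klineZeros x).powersetCard Z,
      (if y ∈ SubFibre x C₀ then ω (kline x) C₀ else 0)) ≤ (2 : ℝ) ^ Z := by
  classical
  have hterm : ∀ x ∈ univ.filter (fun x : Fin N → Bool => IsOdd x),
      (∑ C₀ ∈ (klineZeros x).powersetCard Z, (if y ∈ SubFibre x C₀ then ω (kline x) C₀ else 0)) =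
        ∑ C₀ ∈ (klineZeros y).powersetCard Z, (if y ∈ SubFibre x C₀ then ω (kline y) C₀ else 0) := by
    intro x _
    by_cases hk : kline y = kline x
    · have : klineZeros x = klineZeros y := by unfold klineZeros; rw [hk]
      rw [this, hk]
    · have h0 : ∀ C₀, ¬ (y ∈ SubFibre x C₀) := by
        intro C₀ h
        unfold SubFibre at h
        rw [mem_filter] at h
        exact hk h.2.2.1
      simp only [h0, if_false, sum_const_zero]
  rw [sum_congr rfl hterm, sum_comm]
  have hcount : ∀ C₀ ∈ (klineZeros y).powersetCard Z,
      (∑ x ∈ univ.filter (fun x : Fin N → Bool => IsOdd x), (if y ∈ SubFibre x C₀ then ω (kline y) C₀ else 0)) ≤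
        (2 : ℝ) ^ Z * ω (kline y) C₀ := by
    intro C₀ hC₀
    rw [mem_powersetCard] at hC₀
    rw [← sum_filter, sum_const, nsmul_eq_mul]
    have hsub : ((univ.filter (fun x : Fin N → Bool => IsOdd x)).filter fun x => y ∈ SubFibre x C₀).card ≤
        ((univ.filter (fun x : Fin N → Bool => IsOdd x)).filter fun x => ∀ i, i ∉ C₀ → y i = x i).card := by
      refine card_le_card fun x hx => ?_
      rw [mem_filter] at hx ⊢
      refine ⟨hx.1, ?_⟩
      have h := hx.2
      unfold SubFibre at h
      rw [mem_filter] at h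
      exact h.2.2.2
    have h2 := card_agree_off_le y C₀ (univ.filter (fun x : Fin N → Bool => IsOdd x))
    rw [hC₀.2] at h2
    have h3 : (((univ.filter (fun x : Fin N → Bool => IsOdd x)).filter fun x => y ∈ SubFibre x C₀).card : ℝ) ≤ (2 : ℝ) ^ Z := by
      exact_mod_cast hsub.trans h2
    exact mul_le_mul_of_nonneg_right h3 (hω.1 _ _)
  calc ∑ C₀ ∈ (klineZeros y).powersetCard Z, ∑ x ∈ univ.filter (fun x : Fin N → Bool => IsOdd x),
          (if y ∈ SubFibre x C₀ then ω (kline y) C₀ else 0)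
      ≤ ∑ C₀ ∈ (klineZeros y).powersetCard Z, (2 : ℝ) ^ Z * ω (kline y) C₀ := sum_le_sum hcount
    _ = (2 : ℝ) ^ Z * ∑ C₀ ∈ (klineZeros y).powersetCard Z, ω (kline y) C₀ := by rw [mul_sum]
    _ ≤ (2 : ℝ) ^ Z * 1 := mul_le_mul_of_nonneg_left (hω.2 (kline y)) (by positivity)
    _ = (2 : ℝ) ^ Z := mul_one _

open scoped Classical in
/-- **THE WEIGHTED DOUBLE COUNT (PROVED):** for a refuting certificate and ANY window law, `mass ≤ 2^Z · #{odd losers}`. -/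
theorem massCount {W : ∀ {N : ℕ}, (Fin N → Fin N → ZMod 3) → (Fin N → ZMod 3) → (Fin N → Bool) → Finset (Fin N) → Prop}
    (hR : Refuting @W) (hN : 3 ≤ N) {Z : ℕ} {ω : (Fin N → Bool) → Finset (Fin N) → ℝ} (hω : WindowLaw Z ω)
    (β : Fin N → Fin N → ZMod 3) (c : Fin N → ZMod 3) :
    mass @W Z ω β c ≤ (2 : ℝ) ^ Z * ((2 : ℝ) ^ (N - 1) - (affWinCard β c : ℝ)) := by
  classical
  set Odd := univ.filter (fun x : Fin N → Bool => IsOdd x) with hOdd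
  set Lost := Odd.filter fun ℓ => ¬ RingHLF.Rel ℓ (affBell β c ℓ) with hLost
  have hpt : ∀ x ∈ Odd, ∀ C₀ ∈ (klineZeros x).powersetCard Z,
      (if W β c x C₀ then ω (kline x) C₀ else 0) ≤ ∑ ℓ ∈ Lost, (if ℓ ∈ SubFibre x C₀ then ω (kline x) C₀ else 0) := by
    intro x hx C₀ hC₀
    have hnn : ∀ ℓ ∈ Lost, 0 ≤ (if ℓ ∈ SubFibre x C₀ then ω (kline x) C₀ else 0) := by
      intro ℓ _
      split_ifs
      · exact hω.1 _ _
      · exact le_rfl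
    split_ifs with h
    · obtain ⟨ℓ, hℓ, hlost⟩ := hR N hN β c x C₀ (mem_filter.1 hx).2 (mem_powersetCard.1 hC₀).1 h
      have hℓodd : IsOdd ℓ := by
        have := hℓ
        unfold SubFibre at this
        rw [mem_filter] at this
        exact this.2.1
      have hmem : ℓ ∈ Lost := by
        rw [hLost, mem_filter, hOdd, mem_filter]
        exact ⟨⟨mem_univ _, hℓodd⟩, hlost⟩
      refine le_trans ?_ (single_le_sum (f := fun ℓ : Fin N → Bool => if ℓ ∈ SubFibre x C₀ then ω (kline x) C₀ else 0) hnn hmem)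
      simp only [if_pos hℓ, le_refl]
    · exact sum_nonneg hnn
  have hlost : (Lost.card : ℝ) = (2 : ℝ) ^ (N - 1) - (affWinCard β c : ℝ) := card_odd_losers (by omega) β c
  unfold mass
  calc (∑ x ∈ Odd, ∑ C₀ ∈ (klineZeros x).powersetCard Z, if W β c x C₀ then ω (kline x) C₀ else 0)
      ≤ ∑ x ∈ Odd, ∑ C₀ ∈ (klineZeros x).powersetCard Z, ∑ ℓ ∈ Lost, (if ℓ ∈ SubFibre x C₀ then ω (kline x) C₀ else 0) :=
        sum_le_sum fun x hx => sum_le_sum fun C₀ hC₀ => hpt x hx C₀ hC₀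
    _ = ∑ x ∈ Odd, ∑ ℓ ∈ Lost, ∑ C₀ ∈ (klineZeros x).powersetCard Z, (if ℓ ∈ SubFibre x C₀ then ω (kline x) C₀ else 0) :=
        sum_congr rfl fun x _ => sum_comm
    _ = ∑ ℓ ∈ Lost, ∑ x ∈ Odd, ∑ C₀ ∈ (klineZeros x).powersetCard Z, (if ℓ ∈ SubFibre x C₀ then ω (kline x) C₀ else 0) := sum_comm
    _ ≤ ∑ ℓ ∈ Lost, (2 : ℝ) ^ Z := sum_le_sum fun ℓ _ => inner_le_law hω ℓ
    _ = (2 : ℝ) ^ Z * (Lost.card : ℝ) := by rw [sum_const, nsmul_eq_mul, mul_comm]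
    _ = (2 : ℝ) ^ Z * ((2 : ℝ) ^ (N - 1) - (affWinCard β c : ℝ)) := by rw [hlost]

/-- `(β, c)` carries `W`-mass `≥ δ·2^{N-1}` under SOME window law at `Z` coins. -/
def LawDense (W : ∀ {N : ℕ}, (Fin N → Fin N → ZMod 3) → (Fin N → ZMod 3) → (Fin N → Bool) → Finset (Fin N) → Prop)
    (δ : ℝ) (Z : ℕ) (β : Fin N → Fin N → ZMod 3) (c : Fin N → ZMod 3) : Prop :=
  ∃ ω : (Fin N → Bool) → Finset (Fin N) → ℝ, WindowLaw Z ω ∧ δ * (2 : ℝ) ^ (N - 1) ≤ mass @W Z ω β c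

/-- One strategy: law-density `1/N^a` at `Z ≤ K·log₂N` coins ⇒ at most a `(1 − 1/N^{a+K})` fraction of the odd class is won. -/
theorem affWin_le_of_lawDense {W : ∀ {N : ℕ}, (Fin N → Fin N → ZMod 3) → (Fin N → ZMod 3) → (Fin N → Bool) → Finset (Fin N) → Prop}
    (hR : Refuting @W) (hN : 3 ≤ N) (a K Z : ℕ) (hZ : Z ≤ K * Nat.log 2 N) (β : Fin N → Fin N → ZMod 3) (c : Fin N → ZMod 3)
    (h : LawDense @W ((1 : ℝ) / (N : ℝ) ^ a) Z β c) :
    (affWinCard β c : ℝ) ≤ (1 - 1 / (N : ℝ) ^ (a + K)) * (2 : ℝ) ^ (N - 1) := by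
  obtain ⟨ω, hω, hm⟩ := h
  have hNpos : (0 : ℝ) < N := by exact_mod_cast (show 0 < N by omega)
  have key := massCount hR hN hω β c
  have hlog : ((2 : ℕ) ^ Nat.log 2 N : ℝ) ≤ (N : ℝ) := by exact_mod_cast Nat.pow_log_le_self 2 (by omega : N ≠ 0)
  have h2Z : (2 : ℝ) ^ Z ≤ (N : ℝ) ^ K := by
    calc (2 : ℝ) ^ Z ≤ (2 : ℝ) ^ (K * Nat.log 2 N) := pow_le_pow_right₀ (by norm_num) hZ
      _ = ((2 : ℝ) ^ Nat.log 2 N) ^ K := by rw [mul_comm, pow_mul]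
      _ ≤ (N : ℝ) ^ K := pow_le_pow_left₀ (by positivity) (by exact_mod_cast hlog) K
  have hposZ : (0 : ℝ) < (2 : ℝ) ^ Z := by positivity
  set D := (2 : ℝ) ^ (N - 1) - (affWinCard β c : ℝ) with hD
  have hlhs : (0 : ℝ) < 1 / (N : ℝ) ^ a * (2 : ℝ) ^ (N - 1) := by positivity
  have hDpos : 0 < D := by
    have : 0 < (2 : ℝ) ^ Z * D := lt_of_lt_of_le hlhs (hm.trans key)
    exact (mul_pos_iff_of_pos_left hposZ).1 this
  have hNK : (0 : ℝ) < (N : ℝ) ^ K := by positivity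
  have h1 : 1 / (N : ℝ) ^ a * (2 : ℝ) ^ (N - 1) ≤ (N : ℝ) ^ K * D :=
    (hm.trans key).trans (mul_le_mul_of_nonneg_right h2Z hDpos.le)
  have h2 : (1 / (N : ℝ) ^ a * (2 : ℝ) ^ (N - 1)) / (N : ℝ) ^ K ≤ D := by
    rw [div_le_iff₀ hNK]
    linarith
  have e : (1 - 1 / (N : ℝ) ^ (a + K)) * (2 : ℝ) ^ (N - 1) = (2 : ℝ) ^ (N - 1) - (1 / (N : ℝ) ^ a * (2 : ℝ) ^ (N - 1)) / (N : ℝ) ^ K := by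
    rw [pow_add]
    field_simp
  rw [e]
  linarith

/-- **GENERIC FAR-SIDE HYPOTHESIS with laws.** For the certificate `W`: far from every frame ⇒ the strategy already loses `N^{-a}`, or `(β,c)`
carries `W`-mass `≥ N^{-a}·2^{N-1}` under some window law at `≤ K·log₂N` coins. -/
def HLaw (W : ∀ {N : ℕ}, (Fin N → Fin N → ZMod 3) → (Fin N → ZMod 3) → (Fin N → Bool) → Finset (Fin N) → Prop) : Prop :=
  ∃ δ₀ : ℝ, δ₀ < 1 / 2 ∧ ∃ r₀ w₀ a K N₀ : ℕ, ∀ N ≥ N₀, ∀ (β : Fin N → Fin N → ZMod 3) (c : Fin N → ZMod 3),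
    ¬ FrameDecomp δ₀ r₀ w₀ β →
      (affWinCard β c : ℝ) ≤ (1 - 1 / (N : ℝ) ^ a) * (2 : ℝ) ^ (N - 1) ∨
        ∃ Z ≤ K * Nat.log 2 N, LawDense @W ((1 : ℝ) / (N : ℝ) ^ a) Z β c

/-- **ASSEMBLY with laws (PROVED):** a refuting certificate whose law-version holds on the far side gives (NP₁), `e = a + K + 1`. -/
theorem polyLoss_of_law {W : ∀ {N : ℕ}, (Fin N → Fin N → ZMod 3) → (Fin N → ZMod 3) → (Fin N → Bool) → Finset (Fin N) → Prop}
    (hR : Refuting @W) (hL : HLaw @W) (hF : AffFrameLoss) : AffBellsPolyLoss3 := by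
  obtain ⟨δ₀, hδ₀, r₀, w₀, a, K, N₀, hfar⟩ := hL
  obtain ⟨θ, hθ, n₀, hn₀⟩ := hF δ₀ hδ₀ r₀ w₀
  obtain ⟨M, hM⟩ := exists_nat_gt (1 / (1 - θ))
  refine ⟨a + K + 1, max (max N₀ n₀) (max M 3), fun N hN β c => ?_⟩
  have hN₀ : N₀ ≤ N := le_trans (le_max_left _ _) (le_trans (le_max_left _ _) hN)
  have hn₀' : n₀ ≤ N := le_trans (le_max_right _ _) (le_trans (le_max_left _ _) hN)
  have hM' : M ≤ N := le_trans (le_max_left _ _) (le_trans (le_max_right _ _) hN)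
  have h3 : 3 ≤ N := le_trans (le_max_right _ _) (le_trans (le_max_right _ _) hN)
  have hNpos : (0 : ℝ) < N := by exact_mod_cast (show 0 < N by omega)
  have hN1 : (1 : ℝ) ≤ N := by exact_mod_cast (show 1 ≤ N by omega)
  have h2pow : (0 : ℝ) < (2 : ℝ) ^ (N - 1) := by positivity
  have hθ1 : 0 < 1 - θ := by linarith
  by_cases hdec : FrameDecomp δ₀ r₀ w₀ β
  · have hwin := hn₀ N hn₀' β c hdec
    have hMpos : (0 : ℝ) < M := by
      have : (0 : ℝ) < 1 / (1 - θ) := by positivity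
      linarith
    have hinv : 1 / (N : ℝ) ≤ 1 - θ := by
      have h1 : 1 / (N : ℝ) ≤ 1 / (M : ℝ) := one_div_le_one_div_of_le hMpos (by exact_mod_cast hM')
      have h2 : 1 / (M : ℝ) < 1 - θ := by
        rw [div_lt_iff₀ hMpos]
        have := (div_lt_iff₀ hθ1).mp hM
        linarith
      linarith
    have hpow : 1 / (N : ℝ) ^ (a + K + 1) ≤ 1 / (N : ℝ) := by
      apply one_div_le_one_div_of_le hNpos
      calc (N : ℝ) = (N : ℝ) ^ 1 := (pow_one _).symm
        _ ≤ (N : ℝ) ^ (a + K + 1) := pow_le_pow_right₀ hN1 (by omega)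
    have : θ * (2 : ℝ) ^ (N - 1) ≤ (1 - 1 / (N : ℝ) ^ (a + K + 1)) * (2 : ℝ) ^ (N - 1) := by
      apply mul_le_mul_of_nonneg_right _ h2pow.le
      linarith
    exact hwin.trans this
  · rcases hfar N hN₀ β c hdec with hlow | ⟨Z, hZ, hd⟩
    · refine hlow.trans (mul_le_mul_of_nonneg_right ?_ h2pow.le)
      have hle : (N : ℝ) ^ a ≤ (N : ℝ) ^ (a + K + 1) := pow_le_pow_right₀ hN1 (by omega)
      have := one_div_le_one_div_of_le (by positivity) hle
      linarith
    · have hwin := affWin_le_of_lawDense hR h3 a K Z hZ β c hd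
      refine hwin.trans (mul_le_mul_of_nonneg_right ?_ h2pow.le)
      have hle : (N : ℝ) ^ (a + K) ≤ (N : ℝ) ^ (a + K + 1) := pow_le_pow_right₀ hN1 (by omega)
      have := one_div_le_one_div_of_le (by positivity) hle
      linarith

/-- **`HCube` — the cube-witness far side with laws (conjecture; the weakest structural far-side statement of this file).** -/
def HCube : Prop := HLaw @CubeWitness

/-- **(NP₁) from `HCube` alone (PROVED: `cubeRefutes`, `massCount`, `AffBells27.affFrameLoss`).** -/
theorem polyLoss_of_cube (h : HCube) : AffBellsPolyLoss3 := polyLoss_of_law cubeRefutes h affFrameLoss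

/-- Mass is monotone in the certificate (pointwise implication on odd points and coin windows). -/
theorem mass_mono {W₁ W₂ : ∀ {N : ℕ}, (Fin N → Fin N → ZMod 3) → (Fin N → ZMod 3) → (Fin N → Bool) → Finset (Fin N) → Prop}
    {Z : ℕ} {ω : (Fin N → Bool) → Finset (Fin N) → ℝ} (hω : WindowLaw Z ω) {β : Fin N → Fin N → ZMod 3} {c : Fin N → ZMod 3}
    (h : ∀ (x : Fin N → Bool) (C₀ : Finset (Fin N)), IsOdd x → C₀ ⊆ klineZeros x → C₀.card = Z → W₁ β c x C₀ → W₂ β c x C₀) :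
    mass @W₁ Z ω β c ≤ mass @W₂ Z ω β c := by
  classical
  unfold mass
  refine sum_le_sum fun x hx => sum_le_sum fun C₀ hC₀ => ?_
  have hodd : IsOdd x := (mem_filter.1 hx).2
  have hC := mem_powersetCard.1 hC₀
  by_cases h1 : W₁ β c x C₀
  · rw [if_pos h1, if_pos (h x C₀ hodd hC.1 hC.2 h1)]
  · rw [if_neg h1]
    split_ifs
    · exact hω.1 _ _
    · exact le_rfl

end AffBells29

end Summit.QuantumAdvantage.AdviceFreeQNC0
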